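import Literature.Probability.Percolation.DiagonalBoxCrossing
import Literature.Probability.Percolation.CrossingChains
import Literature.Probability.Percolation.RSWLemma
import HarnessLib

/-!
# Inputs of the half-plane arm gluing for the axis half-plane `{v₁ ≥ 0}` of `ℤ²` at `p = 1/2`

Topic `Literature/Probability/Percolation`; proofs only (no definition, no named fact). The files
`HalfPlaneUCatch.lean`, `HalfPlaneCrossingGluing.lean`, `HalfPlaneOneArmQuasiMultiplicativity.lean`
are written for abstract integer coordinates `X, Y : ℤ² → ℤ`; this file discharges their
hypotheses for the AXIS coordinates `X v = v 0`, `Y v = v 1`: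

* `axis_X_le`, `axis_Y_le`, `axis_injective` — the coordinates move by at most one along an
  edge and determine the site;
* `axis_re`, `axis_im` — they are `re / √2`, `im / √2` of the isoradial drawing
  `squareLatticeEmbedding = √2 ℤ²` (so the planar crossing lemma applies);
* `axis_rswLR`, `axis_rswTB` — **the Russo–Seymour–Welsh inputs at `p = 1/2`**: uniform lower
  bounds for the fuzzy left–right / top–bottom crossing events of `k m × m` boxes at all
  integer positions, from the tree's `rsw_lowerBound_holds` (Bollobás–Riordan 2006, Ch. 3),
  translation invariance and the transposition symmetry (`real_tbCrossing`);
* `axisArm_eq` — the crux's half-plane one-arm event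
  `{0 ↔ {y₀ = ±n} ∪ {y₁ = n} in [-n, n] × [0, n]}` IS the arm event of the abstract layer based at
  the origin.

## References

* B. Bollobás, O. Riordan, *Percolation* (2006), Ch. 3 (RSW at `p = 1/2`). [BollobasRiordan2006]
* G. Grimmett, *Percolation* (1999), §11.7. [GrimmettPercolation1999]
-/

noncomputable section

namespace Literature.Probability.Percolation

open MeasureTheory Set LatticeModels

namespace HalfPlaneArm

/-! ### The coordinates -/

/-- `v 0` moves by at most one along an edge. [folklore] -/
theorem axis_X_le (u v : Site 2) (h : (zdGraph 2).Adj u v) : v 0 ≤ u 0 + 1 :=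
  (zdGraph_adj_apply_le h 0).1

/-- `v 1` moves by at most one along an edge. [folklore] -/
theorem axis_Y_le (u v : Site 2) (h : (zdGraph 2).Adj u v) : v 1 ≤ u 1 + 1 :=
  (zdGraph_adj_apply_le h 1).1

/-- A site of `ℤ²` is determined by its two coordinates. [folklore] -/
theorem axis_injective : Function.Injective fun v : Site 2 => (v 0, v 1) := by
  intro v w h
  simp only [Prod.mk.injEq] at h
  funext i
  fin_cases i
  exacts [h.1, h.2]

/-- The axis coordinates are `re / √2`, `im / √2` of `squareLatticeEmbedding`. [folklore] -/
theorem axis_re (v : Site 2) : (squareLatticeEmbedding.z v).re = Real.sqrt 2 * ((v 0 : ℤ) : ℝ) :=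
  TrackExchange.zsq_re v

/-- The axis coordinates are `re / √2`, `im / √2` of `squareLatticeEmbedding`. [folklore] -/
theorem axis_im (v : Site 2) : (squareLatticeEmbedding.z v).im = Real.sqrt 2 * ((v 1 : ℤ) : ℝ) :=
  TrackExchange.zsq_im v

/-! ### Russo–Seymour–Welsh inputs at `p = 1/2` -/

/-- The RSW constant of aspect ratio `k` bounds the crossing probability of every `k m × m`
rectangle, `m ≥ 0`. [cite: BollobasRiordan2006, Ch. 3 (RSW at p = 1/2)] -/
theorem crossingProb_ge_rsw {k : ℕ} (hk : 2 ≤ k) : ∃ c : ℝ, 0 < c ∧ ∀ m : ℕ, c ≤ crossingProb half (k * m) m := by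
  obtain ⟨c, hc, h⟩ := rsw_lowerBound_holds k hk
  refine ⟨c, hc, fun m => (h (m + 1) (by omega)).trans ?_⟩
  rw [Nat.add_sub_cancel]
  exact crossingProb_anti_left half (by
    have : k * (m + 1) = k * m + k := by ring
    omega) m

/-- **RSW input, left–right**: for every `k ≥ 2` there is `c > 0` such that for all `m` and all
integer positions `(A, B)` the fuzzy box `{A - 2 ≤ v₀ ≤ A + km + 2} × {B ≤ v₁ ≤ B + m}` is crossed
by an open path from `{v₀ ≤ A}` to `{A + km ≤ v₀}` with probability `≥ c` (it contains the exact
`km × m` rectangle at `(A, B)`, crossed with probability `crossingProb half (km) m ≥ c`).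
[cite: BollobasRiordan2006, Ch. 3 (RSW at p = 1/2)] -/
theorem axis_rswLR : ∀ k : ℕ, 2 ≤ k → ∃ c : ℝ, 0 < c ∧ ∃ m₀ : ℕ, ∀ m : ℕ, m₀ ≤ m → ∀ A B : ℤ,
    c ≤ (bondPercolation (zdGraph 2) half).real
      (openCrossing {v : Site 2 | A - 2 ≤ v 0 ∧ v 0 ≤ A + (k : ℤ) * m + 2 ∧ B ≤ v 1 ∧ v 1 ≤ B + (m : ℤ)}
        {v : Site 2 | v 0 ≤ A} {v : Site 2 | A + (k : ℤ) * m ≤ v 0}) := by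
  intro k hk
  obtain ⟨c, hc, h⟩ := crossingProb_ge_rsw hk
  refine ⟨c, hc, 0, fun m _ A B => (h m).trans ?_⟩
  rw [← bondPercolation_real_lrCrossingAt half ![A, B] (k * m) m]
  refine measureReal_mono (openCrossing_mono ?_ ?_ ?_) (measure_ne_top _ _)
  · intro z hz
    rw [mem_image_rectangle_iff] at hz
    simp only [Matrix.cons_val_zero, Matrix.cons_val_one] at hz
    simp only [mem_setOf_eq]
    omega
  · rintro z ⟨w, hw, rfl⟩
    rw [Finset.mem_coe, leftSide, Finset.mem_filter] at hw
    simp only [mem_setOf_eq, Pi.add_apply, Matrix.cons_val_zero]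
    omega
  · rintro z ⟨w, hw, rfl⟩
    rw [Finset.mem_coe, rightSide, Finset.mem_filter] at hw
    simp only [mem_setOf_eq, Pi.add_apply, Matrix.cons_val_zero]
    omega

/-- **RSW input, top–bottom** (transposition symmetry `real_tbCrossing` and translation
invariance `real_openCrossing_shift`). [cite: BollobasRiordan2006, Ch. 3 (RSW at p = 1/2)] -/
theorem axis_rswTB : ∀ k : ℕ, 2 ≤ k → ∃ c : ℝ, 0 < c ∧ ∃ m₀ : ℕ, ∀ m : ℕ, m₀ ≤ m → ∀ A B : ℤ,
    c ≤ (bondPercolation (zdGraph 2) half).real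
      (openCrossing {v : Site 2 | A ≤ v 0 ∧ v 0 ≤ A + (m : ℤ) ∧ B - 2 ≤ v 1 ∧ v 1 ≤ B + (k : ℤ) * m + 2}
        {v : Site 2 | v 1 ≤ B} {v : Site 2 | B + (k : ℤ) * m ≤ v 1}) := by
  intro k hk
  obtain ⟨c, hc, h⟩ := crossingProb_ge_rsw hk
  refine ⟨c, hc, 0, fun m _ A B => (h m).trans ?_⟩
  rw [← real_tbCrossing half (k * m) m, tbCrossing,
    ← real_openCrossing_shift half ![A, B] (↑(rectangle m (k * m))) (↑(bottomSide m (k * m)))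
      (↑(topSide m (k * m)))]
  refine measureReal_mono (openCrossing_mono ?_ ?_ ?_) (measure_ne_top _ _)
  · intro z hz
    rw [mem_image_rectangle_iff] at hz
    simp only [Matrix.cons_val_zero, Matrix.cons_val_one] at hz
    simp only [mem_setOf_eq]
    omega
  · rintro z ⟨w, hw, rfl⟩
    rw [Finset.mem_coe, bottomSide, Finset.mem_filter] at hw
    simp only [mem_setOf_eq, Pi.add_apply, Matrix.cons_val_one, Matrix.cons_val_zero]
    omega
  · rintro z ⟨w, hw, rfl⟩
    rw [Finset.mem_coe, topSide, Finset.mem_filter] at hw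
    simp only [mem_setOf_eq, Pi.add_apply, Matrix.cons_val_one, Matrix.cons_val_zero]
    omega

/-! ### The crux's event is the arm event of the abstract layer -/

/-- **The half-plane one-arm event of the crux in the abstract form**: for `n : ℕ`,
`{∃ y, (y₀ = n ∨ y₀ = -n ∨ y₁ = n) ∧ 0 ↔ y in [-n, n] × [0, n]}` is the open crossing, inside
`{0 ≤ v₁, max |v₀ - 0| (v₁ - 0) ≤ n}`, from `{0}` to `{max |v₀ - 0| (v₁ - 0) = n}`. [folklore] -/
theorem axisArm_eq (n : ℕ) :
    {ω : BondConfig (Site 2) | ∃ y : Site 2, (y 0 = (n : ℤ) ∨ y 0 = -(n : ℤ) ∨ y 1 = (n : ℤ)) ∧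
      ω ∈ openConnIn {v : Site 2 | 0 ≤ v 1 ∧ -(n : ℤ) ≤ v 0 ∧ v 0 ≤ n ∧ v 1 ≤ n} 0 y} =
    openCrossing {v : Site 2 | 0 ≤ v 1 ∧ max |v 0 - (0 : Site 2) 0| (v 1 - (0 : Site 2) 1) ≤ n} {0}
      {v : Site 2 | max |v 0 - (0 : Site 2) 0| (v 1 - (0 : Site 2) 1) = n} := by
  have hbox : {v : Site 2 | 0 ≤ v 1 ∧ -(n : ℤ) ≤ v 0 ∧ v 0 ≤ n ∧ v 1 ≤ n} =
      {v : Site 2 | 0 ≤ v 1 ∧ max |v 0 - (0 : Site 2) 0| (v 1 - (0 : Site 2) 1) ≤ n} := by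
    ext v
    simp only [mem_setOf_eq, Pi.zero_apply, sub_zero, max_le_iff, abs_le]
    omega
  ext ω
  constructor
  · rintro ⟨y, hy, h⟩
    have hyS := h.2.1
    refine ⟨0, mem_singleton _, y, ?_, hbox ▸ h⟩
    simp only [mem_setOf_eq] at hyS
    simp only [mem_setOf_eq, Pi.zero_apply, sub_zero]
    refine le_antisymm (max_le (abs_le.2 ⟨by omega, by omega⟩) (by omega)) ?_
    rcases hy with hy | hy | hy
    · exact le_max_of_le_left (by rw [hy]; exact le_abs_self _)
    · exact le_max_of_le_left (by rw [hy, abs_neg]; exact le_abs_self _)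
    · exact le_max_of_le_right hy.ge
  · rintro ⟨x, hx, y, hy, h⟩
    rw [mem_singleton_iff] at hx
    subst hx
    have hyS := h.2.1
    refine ⟨y, ?_, hbox.symm ▸ h⟩
    simp only [mem_setOf_eq, Pi.zero_apply, sub_zero] at hy hyS
    obtain ⟨h0, hmax⟩ := hyS
    rw [max_le_iff, abs_le] at hmax
    rcases max_eq_iff.1 hy with ⟨h1, -⟩ | ⟨h1, -⟩
    · rcases (abs_eq (by positivity : (0 : ℤ) ≤ n)).1 h1 with h2 | h2
      · exact Or.inl h2
      · exact Or.inr (Or.inl h2)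
    · exact Or.inr (Or.inr h1)

end HalfPlaneArm

end Literature.Probability.Percolation
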